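import Summits.BirchSwinnertonDyer.Rank1Residual.Additive.GoodModelKummerOfCoatesGreenberg
import Summits.BirchSwinnertonDyer.BirchSwinnertonDyer.Theorems.ThetaPartnerAtTwoSignedControlAtTwoCoatesGreenbergUnconditional
import HarnessLib

set_option linter.dupNamespace false -- `…BirchSwinnertonDyer.BirchSwinnertonDyer…` is the cell's nested layout (D-0017)
set_option autoImplicit false

/-!
# Greenberg LNM 1716 §2 Prop. 2.4 (`Im λ_K ⊆ Im κ_K` over the cyclotomic tower at a good ORDINARY prime) HOLDS:
# the named facts `Greenberg1999.imKummer_ge_strictCondition_goodOrdinary` (A239) and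
# `…_goodOrdinaryModel` (S2) are theorems of the tree — hypothesis-free `_holds` terms

Seat `bsd-inputs-k4-p1` (gen 4; LADDER-BSD D-0154 KEY (147)(f) «prove the printed input» — Greenberg 1999;
`--supports stmt-BirchSwinnertonDyer-20309`). THEOREMS ONLY (no definition, no named fact, no `sorry`); nothing is restated.

R. Greenberg, *Iwasawa theory for elliptic curves*, LNM 1716 (1999), §2 Prop. 2.4 (pp. 74–75): for `v ∣ p` of good ordinary
reduction and every `K ⊇ (F_∞)_η`, `Im λ_K ⊆ Im κ_K` (strict Greenberg classes are Kummer). The tree typed it twice — for the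
minimal model of `E/ℚ` (`Greenberg1999.imKummer_ge_strictCondition_goodOrdinary`, record A239, binder `hGrK` of the
Rank1Residual / AdditiveBranchIMC / X1–X4 files: > 1 200 occurrences) and for a good model `W₀ = C • E ⊗ K̄_v`
(`…_goodOrdinaryModel`, S2/A249) — and DERIVED both from the Coates–Greenberg record
`CoatesGreenberg1996.H1_goodModelKernel_trivial` (cell b2b-bsdres: `Rank1Residual.Additive.GoodModelLine.imKummer_ge_
strictCondition_goodOrdinary(Model)_of_coatesGreenberg`). Since 2026-08-28 that record is PROVED at universe `0`
(`Theorems.H1_goodModelKernel_trivial_holds`, Tate's almost étale lemma, cell bsd-wall). This file records the composition: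

* `imKummer_ge_strictCondition_goodOrdinaryModel_holds : Greenberg1999.imKummer_ge_strictCondition_goodOrdinaryModel` (S2);
* `imKummer_ge_strictCondition_goodOrdinary_holds : Greenberg1999.imKummer_ge_strictCondition_goodOrdinary` (A239) — every
  binder `(hGrK : Greenberg1999.imKummer_ge_strictCondition_goodOrdinary)` is discharged by this term;
* `ramifiedLineKummerEqAt_of_classX4Gord`, `ramifiedLineKummerEqAt_of_classX3Gord` — the δ-input
  `Rank1Residual.Additive.RamifiedLineKummerEqAt W p` on the classes X4♯(G-ord) (every `p`) and X3♯(G-ord) (odd `p`) with NO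
  Coates–Greenberg binder (b2b-bsdres' `ClassX4Gord/ClassX3Gord.ramifiedLineKummerEqAt_of_coatesGreenberg` fed the proved
  record).

HONEST FRAMING: compositions of tree theorems (the mathematics is Tate's almost étale lemma — cell bsd-wall — and b2b-bsdres'
Kummer derivation); Greenberg's Prop. 2.4 AS TYPED is now unconditional; no item is closed; no crux and no summit statement is
proved; BSD is not proved by any of this.

References: [GreenbergLNM1716] §2 Prop. 2.4 (pp. 74–75), p. 83; [CoatesGreenberg1996] Thm. 2.13, Cor. 3.2, Prop. 4.3;
[Tate1967] §3.2 Prop. 9.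
-/

noncomputable section

namespace Summit.BirchSwinnertonDyer.BirchSwinnertonDyer.Theorems.InputsGreenbergKummerImage

open Literature.NumberTheory.EllipticCurves Literature.NumberTheory.EllipticCurves.Greenberg1999
  Summit.BirchSwinnertonDyer.Rank1Residual.Additive

/-- **Greenberg LNM 1716 Prop. 2.4 for a good ordinary MODEL `W₀ = C • E ⊗ K̄_v` HOLDS** (S2 / A249,
`Greenberg1999.imKummer_ge_strictCondition_goodOrdinaryModel`): the Coates–Greenberg derivation
`GoodModelLine.imKummer_ge_strictCondition_goodOrdinaryModel_of_coatesGreenberg` fed the proved record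
`H1_goodModelKernel_trivial_holds`. [cite: GreenbergLNM1716, §2 Prop. 2.4 (pp. 74–75) and p. 83]
[cite: CoatesGreenberg1996, Cor. 3.2 and Prop. 4.3] -/
theorem imKummer_ge_strictCondition_goodOrdinaryModel_holds : imKummer_ge_strictCondition_goodOrdinaryModel :=
  GoodModelLine.imKummer_ge_strictCondition_goodOrdinaryModel_of_coatesGreenberg H1_goodModelKernel_trivial_holds

/-- **Greenberg LNM 1716 Prop. 2.4 for `E/ℚ` good ordinary at `p` HOLDS** (A239,
`Greenberg1999.imKummer_ge_strictCondition_goodOrdinary`: over every layer `H ≤ ker κ` of finite index of the cyclotomic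
tower, strict Greenberg classes at the place above `p` are Kummer) — the `hGrK` binder of the Rank1Residual / AdditiveBranchIMC
files, discharged. [cite: GreenbergLNM1716, §2 Prop. 2.4 (pp. 74–75) and p. 83] [cite: CoatesGreenberg1996, Cor. 3.2 and Prop. 4.3] -/
theorem imKummer_ge_strictCondition_goodOrdinary_holds : imKummer_ge_strictCondition_goodOrdinary :=
  GoodModelLine.imKummer_ge_strictCondition_goodOrdinary_of_coatesGreenberg H1_goodModelKernel_trivial_holds

/-- **The δ-input `RamifiedLineKummerEqAt W p` on X4♯(G-ord), every `p`, NO Coates–Greenberg binder**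
(`ClassX4Gord.ramifiedLineKummerEqAt_of_coatesGreenberg` fed `H1_goodModelKernel_trivial_holds`).
[cite: GreenbergLNM1716, §2 Prop. 2.4 (pp. 74–75), p. 83] [cite: GreenbergVatsal2000, §2 p. 26] -/
theorem ramifiedLineKummerEqAt_of_classX4Gord (W : WeierstrassCurve ℚ) [W.IsElliptic] [W.IsGloballyMinimal] (p : ℕ)
    [Fact p.Prime] (hX : ClassX4Gord W p) : RamifiedLineKummerEqAt W p :=
  GoodModelLine.ClassX4Gord.ramifiedLineKummerEqAt_of_coatesGreenberg W p H1_goodModelKernel_trivial_holds hX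

/-- **The δ-input `RamifiedLineKummerEqAt W p` on X3♯(G-ord), odd `p`, NO Coates–Greenberg binder**
(`ClassX3Gord.ramifiedLineKummerEqAt_of_coatesGreenberg` fed `H1_goodModelKernel_trivial_holds`).
[cite: GreenbergLNM1716, §2 Prop. 2.4 (pp. 74–75), p. 83] [cite: GreenbergVatsal2000, §2 p. 26] -/
theorem ramifiedLineKummerEqAt_of_classX3Gord (W : WeierstrassCurve ℚ) [W.IsElliptic] [W.IsGloballyMinimal] (p : ℕ)
    [Fact p.Prime] (hp2 : p ≠ 2) (hX : ClassX3Gord W p) : RamifiedLineKummerEqAt W p :=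
  GoodModelLine.ClassX3Gord.ramifiedLineKummerEqAt_of_coatesGreenberg W p H1_goodModelKernel_trivial_holds hp2 hX

end Summit.BirchSwinnertonDyer.BirchSwinnertonDyer.Theorems.InputsGreenbergKummerImage

end
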